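import Summits.RiemannHypothesis.RiemannHypothesis.Theorems.WeilTwoPrimeDeflE25ODef
import Summits.RiemannHypothesis.RiemannHypothesis.Theorems.WeilTwoPrimeDeflE25ODataPO29
import Literature.NumberTheory.LFunctions.WeilBlockRowsR
import HarnessLib

/-!
# Deflated two-prime certificate E25O: the materialized odd block agrees with `P_r + Σ μ ĉ ĉᵀ`, rows 40–49

`WeilCert.checkPmRowG` for certificate E25O (odd block), by `decide +kernel`. Pure proof file; nothing is asserted.
-/

set_option linter.dupNamespace false

noncomputable section

namespace Summit.RiemannHypothesis.RiemannHypothesis.Theorems.EvenWinsBeyondArch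

open Literature.NumberTheory.LFunctions

set_option maxHeartbeats 0 in
/-- Row 40 of the materialized odd block is row 40 of `P_r + Σ μ ĉ ĉᵀ` (certificate E25O). [folklore] -/
theorem checkPmRowG1_40_weilCertDeflE25O : weilCertDeflE25OBase.checkPmRowG weilCertDeflE25OP weilCertDeflE25OPmO 1 40 = true := by
  decide +kernel

set_option maxHeartbeats 0 in
/-- Row 41 of the materialized odd block is row 41 of `P_r + Σ μ ĉ ĉᵀ` (certificate E25O). [folklore] -/
theorem checkPmRowG1_41_weilCertDeflE25O : weilCertDeflE25OBase.checkPmRowG weilCertDeflE25OP weilCertDeflE25OPmO 1 41 = true := by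
  decide +kernel

set_option maxHeartbeats 0 in
/-- Row 42 of the materialized odd block is row 42 of `P_r + Σ μ ĉ ĉᵀ` (certificate E25O). [folklore] -/
theorem checkPmRowG1_42_weilCertDeflE25O : weilCertDeflE25OBase.checkPmRowG weilCertDeflE25OP weilCertDeflE25OPmO 1 42 = true := by
  decide +kernel

set_option maxHeartbeats 0 in
/-- Row 43 of the materialized odd block is row 43 of `P_r + Σ μ ĉ ĉᵀ` (certificate E25O). [folklore] -/
theorem checkPmRowG1_43_weilCertDeflE25O : weilCertDeflE25OBase.checkPmRowG weilCertDeflE25OP weilCertDeflE25OPmO 1 43 = true := by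
  decide +kernel

set_option maxHeartbeats 0 in
/-- Row 44 of the materialized odd block is row 44 of `P_r + Σ μ ĉ ĉᵀ` (certificate E25O). [folklore] -/
theorem checkPmRowG1_44_weilCertDeflE25O : weilCertDeflE25OBase.checkPmRowG weilCertDeflE25OP weilCertDeflE25OPmO 1 44 = true := by
  decide +kernel

set_option maxHeartbeats 0 in
/-- Row 45 of the materialized odd block is row 45 of `P_r + Σ μ ĉ ĉᵀ` (certificate E25O). [folklore] -/
theorem checkPmRowG1_45_weilCertDeflE25O : weilCertDeflE25OBase.checkPmRowG weilCertDeflE25OP weilCertDeflE25OPmO 1 45 = true := by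
  decide +kernel

set_option maxHeartbeats 0 in
/-- Row 46 of the materialized odd block is row 46 of `P_r + Σ μ ĉ ĉᵀ` (certificate E25O). [folklore] -/
theorem checkPmRowG1_46_weilCertDeflE25O : weilCertDeflE25OBase.checkPmRowG weilCertDeflE25OP weilCertDeflE25OPmO 1 46 = true := by
  decide +kernel

set_option maxHeartbeats 0 in
/-- Row 47 of the materialized odd block is row 47 of `P_r + Σ μ ĉ ĉᵀ` (certificate E25O). [folklore] -/
theorem checkPmRowG1_47_weilCertDeflE25O : weilCertDeflE25OBase.checkPmRowG weilCertDeflE25OP weilCertDeflE25OPmO 1 47 = true := by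
  decide +kernel

set_option maxHeartbeats 0 in
/-- Row 48 of the materialized odd block is row 48 of `P_r + Σ μ ĉ ĉᵀ` (certificate E25O). [folklore] -/
theorem checkPmRowG1_48_weilCertDeflE25O : weilCertDeflE25OBase.checkPmRowG weilCertDeflE25OP weilCertDeflE25OPmO 1 48 = true := by
  decide +kernel

set_option maxHeartbeats 0 in
/-- Row 49 of the materialized odd block is row 49 of `P_r + Σ μ ĉ ĉᵀ` (certificate E25O). [folklore] -/
theorem checkPmRowG1_49_weilCertDeflE25O : weilCertDeflE25OBase.checkPmRowG weilCertDeflE25OP weilCertDeflE25OPmO 1 49 = true := by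
  decide +kernel


end Summit.RiemannHypothesis.RiemannHypothesis.Theorems.EvenWinsBeyondArch
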